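import Summits.ABC.ABC.Theses.IneffectiveSubspace
import Summits.ABC.ABC.Cruxes.DeepRegimeABC.StrategistSplit_s1
import Summits.ABC.ABC.Theorems.IneffectiveSubspaceDeepRegimeABCRoughPowerfulTail
import Summits.ABC.ABC.Theorems.IneffectiveSubspaceDeepRegimeABCOmegaTail
import Summits.ABC.ABC.Theorems.IneffectiveSubspaceAbcGivesUniformSadic

/-!
# Crux `DeepRegimeABC` (stmt-ABC-15121) — crux-strategist r1 (RESTATED re-exam, BC2 redirect):
# every typed decomposition `X₁ ∧ … ∧ X_k → DeepRegimeABC` that was examined, with its glue PROVED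

Companion to `Cruxes/DeepRegimeABC/STRATEGY-CENSUS.md` §"Re-exam r1".  Sorry-free.  Nothing here is an
engine: the file TYPES the candidate pieces of each decomposition D1–D7 of the census, proves each
assembly (criterion (b)), and proves the sandwich facts `DeepRegimeABC → piece` / `ABC → piece` that
locate every piece BELOW the crux (so no piece is a strengthening in costume).  The cheap probes of
criterion (c) (`piece → DeepRegimeABC`, `piece → ABC` by `first | exact? | simpa | aesop` must FAIL) are
run in the separate files `ProbeBareX.lean` / `ProbeBareS.lean` (import only the route file + bare copies of
the defs) and `ProbeRich.lean` (imports the landed Theorems too) — item evidence; results tabulated in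
`Cruxes/DeepRegimeABC/PROBES-r1.md` and quoted in the census.  VERDICT of the pass: no-decomposition
(every Dk fails (a), (c) or (d); D2 fails (d) only).

* D1  cored / coreless      : `RidoutCoreBound` (PROVED) ∧ `RoughPowerfulTailABC`      (live line SketchIdeator5R2)
* D2  steep / diffuse-rough : `UniformSadicTowerFour` (crux #2) ∧ `DiffuseRoughDeepTailABC` (strategist s1)
* D2′ bridge form           : `UniformSadicTowerFour` ∧ (`UniformSadicTowerFour → DeepRegimeABC`)
* D3  size regimes          : `XUnbalanced` ∧ `XBalanced`
* D5  exponent bridge       : `XPoly` ∧ (`XPoly → DeepRegimeABC`)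
* D6  smooth corner         : `SmoothFinite` ∧ `XNonSmooth`
* D7  powerful corner       : `PowerfulTailFinite` ∧ `XNotFull`
-/

noncomputable section

-- `Summit.<Summit>.<Problem>` is the mandated summit-side namespace (CONVENTIONS §2); for the
-- single-conjunct summit `ABC` the two coincide, so the duplicate `ABC.ABC` is deliberate.
set_option linter.dupNamespace false

namespace Summit.ABC.ABC.Cruxes.DeepRegimeABC.StrategistR1

open Literature.NumberTheory.DiophantineGeometry (IsABCTriple rad rad_def)
open Summit.ABC.ABC.Theses.IneffectiveSubspace
open Summit.ABC.ABC.Cruxes.DeepRegimeABC.Strategist (DiffuseRoughDeepTailABC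
  deepRegimeABC_of_ustf_of_diffuseRough diffuseRough_of_deepRegimeABC)
open Summit.ABC.ABC.Theorems.DeepRegimeABC (deepRegimeABC_of_roughPowerfulTail
  roughPowerfulTail_of_deepRegimeABC deepRegimeABC_of_abc one_le_rad_rpow')
open scoped BigOperators

/-! ## Common bookkeeping -/

theorem rad_rpow_nonneg (a b c : ℕ) (ε : ℝ) : (0 : ℝ) ≤ ((rad a b c : ℕ) : ℝ) ^ (1 + ε) :=
  Real.rpow_nonneg (Nat.cast_nonneg _) _

/-- A finite set of triples has bounded third coordinate. [folklore] -/
theorem exists_bound_of_finite {s : Set (ℕ × ℕ × ℕ)} (hs : s.Finite) :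
    ∃ B : ℕ, ∀ t ∈ s, t.2.2 ≤ B := by
  obtain ⟨B, hB⟩ := (hs.image (fun t => t.2.2)).bddAbove
  exact ⟨B, fun t ht => hB (Set.mem_image_of_mem _ ht)⟩

/-- Absorbing a bounded exceptional set into the constant. [folklore] -/
theorem lt_max_mul_of_le {c B : ℕ} {C R : ℝ} (hcB : c ≤ B) (hR : 1 ≤ R) :
    (c : ℝ) < max C (B + 1) * R := by
  have hcB' : (c : ℝ) < (B : ℝ) + 1 := by exact_mod_cast Nat.lt_succ_of_le hcB
  have hR0 : 0 ≤ R := zero_le_one.trans hR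
  calc (c : ℝ) < (B : ℝ) + 1 := hcB'
    _ ≤ ((B : ℝ) + 1) * R := le_mul_of_one_le_right (by positivity) hR
    _ ≤ max C (B + 1) * R := mul_le_mul_of_nonneg_right (le_max_right _ _) hR0

/-! ## D1 — cored / coreless (the live line `SketchIdeator5R2`) -/

/-- The live line's open stub S5, verbatim (hypothesis of the landed
`deepRegimeABC_of_roughPowerfulTail`). -/
def RoughPowerfulTailABC : Prop :=
  ∀ ε : ℝ, 0 < ε → ∀ θ : ℝ, 0 < θ → θ * (1 + ε) < ε → ∃ y : ℕ, ∃ K : ℕ, ∃ C : ℝ, 0 < C ∧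
    ∀ a b c : ℕ, IsABCTriple a b c →
      K ≤ ((a * b * c).primeFactors.filter (fun p => 5 ≤ (a * b * c).factorization p)).card →
      θ * Real.log c ≤
        ∑ p ∈ (a * b * c).primeFactors.filter (fun p => ¬ p ≤ y),
          (((a * b * c).factorization p : ℝ) - 1) * Real.log p →
      (c : ℝ) < C * ((rad a b c : ℕ) : ℝ) ^ (1 + ε)

/-- D1 assembly — the second piece `RidoutCoreBound` is a THEOREM (`ridoutCoreBound_holds`), consumed
inside the landed glue; so the join is a one-liner. [folklore] -/
theorem d1_assembly (h : RoughPowerfulTailABC) : DeepRegimeABC := deepRegimeABC_of_roughPowerfulTail h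

/-- D1 fails criterion (c): the open piece is EQUIVALENT to the crux by a landed theorem
(`deepRegimeABC_iff_roughPowerfulTail`, p111766). [folklore] -/
theorem d1_piece_iff_crux : RoughPowerfulTailABC ↔ DeepRegimeABC :=
  ⟨deepRegimeABC_of_roughPowerfulTail, roughPowerfulTail_of_deepRegimeABC⟩

/-! ## D2 — steep / diffuse-rough (strategist s1, `StrategistSplit_s1.lean`) -/

/-- D2 assembly (both pieces open and consumed): crux #2 pays the steep triples through its landed
normal form, Ridout pays the cored ones, `DiffuseRoughDeepTailABC` is the rest. [folklore] -/
theorem d2_assembly (h₂ : UniformSadicTowerFour) (hD : DiffuseRoughDeepTailABC) : DeepRegimeABC :=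
  deepRegimeABC_of_ustf_of_diffuseRough h₂ hD

/-- Both D2 pieces sit below the crux / the summit (no strengthening in costume). [folklore] -/
theorem d2_pieces_of_abc (h : _root_.ABC) : UniformSadicTowerFour ∧ DiffuseRoughDeepTailABC := by
  refine ⟨?_, diffuseRough_of_deepRegimeABC (deepRegimeABC_of_abc h)⟩
  -- `AbcGivesUniformSadic` (stmt-ABC-15071) is landed in Theorems; re-proved here in three lines would
  -- need the radical bookkeeping, so we only record the dependence direction through the crux:
  exact Summit.ABC.ABC.Theorems.abcGivesUniformSadic_proof h

/-- D2′ — the same split in BRIDGE form: `T := crux #2`, bridge `T → X`.  Given #2 the bridge is exactly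
`DiffuseRoughDeepTailABC` (s1's conditional iff), so D2′ and D2 have the same open content. [folklore] -/
def BridgeFromUSTF : Prop := UniformSadicTowerFour → DeepRegimeABC

theorem d2'_assembly (h₂ : UniformSadicTowerFour) (hb : BridgeFromUSTF) : DeepRegimeABC := hb h₂

theorem bridgeFromUSTF_iff_diffuseRough_given (h₂ : UniformSadicTowerFour) :
    BridgeFromUSTF ↔ DiffuseRoughDeepTailABC :=
  ⟨fun hb => diffuseRough_of_deepRegimeABC (hb h₂), fun hD _ => deepRegimeABC_of_ustf_of_diffuseRough h₂ hD⟩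

/-! ## D3 — size regimes (unbalanced `min(a,b) ≤ c^{1−τ}` / balanced) -/

/-- abc on the deep tail for UNBALANCED triples, the prover choosing the balance exponent `τ`. -/
def XUnbalanced : Prop :=
  ∀ ε : ℝ, 0 < ε → ∃ τ : ℝ, 0 < τ ∧ ∃ K : ℕ, ∃ C : ℝ, 0 < C ∧ ∀ a b c : ℕ, IsABCTriple a b c →
    K ≤ ((a * b * c).primeFactors.filter (fun p => 5 ≤ (a * b * c).factorization p)).card →
    ((min a b : ℕ) : ℝ) ≤ (c : ℝ) ^ (1 - τ) →
    (c : ℝ) < C * ((rad a b c : ℕ) : ℝ) ^ (1 + ε)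

/-- abc on the deep tail for BALANCED triples, for every balance exponent `τ`. -/
def XBalanced : Prop :=
  ∀ ε : ℝ, 0 < ε → ∀ τ : ℝ, 0 < τ → ∃ K : ℕ, ∃ C : ℝ, 0 < C ∧ ∀ a b c : ℕ, IsABCTriple a b c →
    K ≤ ((a * b * c).primeFactors.filter (fun p => 5 ≤ (a * b * c).factorization p)).card →
    (c : ℝ) ^ (1 - τ) < ((min a b : ℕ) : ℝ) →
    (c : ℝ) < C * ((rad a b c : ℕ) : ℝ) ^ (1 + ε)

/-- D3 assembly. [folklore] -/
theorem d3_assembly (hU : XUnbalanced) (hB : XBalanced) : DeepRegimeABC := by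
  intro ε hε
  obtain ⟨τ, hτ, K₁, C₁, hC₁, h₁⟩ := hU ε hε
  obtain ⟨K₂, C₂, _hC₂, h₂⟩ := hB ε hε τ hτ
  refine ⟨max K₁ K₂, max C₁ C₂, lt_max_of_lt_left hC₁, fun a b c habc hK => ?_⟩
  have hr := rad_rpow_nonneg a b c ε
  by_cases hle : ((min a b : ℕ) : ℝ) ≤ (c : ℝ) ^ (1 - τ)
  · exact (h₁ a b c habc ((le_max_left _ _).trans hK) hle).trans_le
      (mul_le_mul_of_nonneg_right (le_max_left _ _) hr)
  · exact (h₂ a b c habc ((le_max_right _ _).trans hK) (not_le.mp hle)).trans_le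
      (mul_le_mul_of_nonneg_right (le_max_right _ _) hr)

theorem d3_pieces_of_crux (h : DeepRegimeABC) : XUnbalanced ∧ XBalanced := by
  refine ⟨fun ε hε => ?_, fun ε hε τ _ => ?_⟩
  · obtain ⟨K, C, hC, hK⟩ := h ε hε
    exact ⟨1, one_pos, K, C, hC, fun a b c habc hKle _ => hK a b c habc hKle⟩
  · obtain ⟨K, C, hC, hK⟩ := h ε hε
    exact ⟨K, C, hC, fun a b c habc hKle _ => hK a b c habc hKle⟩

/-! ## D5 — exponent bridge (polynomial abc on one deep cell, then bootstrap to `1+ε`) -/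

/-- Polynomial abc on ONE deep cell: some exponent `A`, some depth `K`. -/
def XPoly : Prop :=
  ∃ A : ℝ, ∃ K : ℕ, ∃ C : ℝ, 0 < C ∧ ∀ a b c : ℕ, IsABCTriple a b c →
    K ≤ ((a * b * c).primeFactors.filter (fun p => 5 ≤ (a * b * c).factorization p)).card →
    (c : ℝ) < C * ((rad a b c : ℕ) : ℝ) ^ A

/-- The bootstrap piece. -/
def XPolyBridge : Prop := XPoly → DeepRegimeABC

theorem d5_assembly (h₁ : XPoly) (h₂ : XPolyBridge) : DeepRegimeABC := h₂ h₁

theorem xPoly_of_crux (h : DeepRegimeABC) : XPoly := by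
  obtain ⟨K, C, hC, hK⟩ := h 1 one_pos
  exact ⟨1 + 1, K, C, hC, fun a b c habc hKle => hK a b c habc hKle⟩

theorem xPolyBridge_of_crux (h : DeepRegimeABC) : XPolyBridge := fun _ => h

/-! ## D6 — smooth corner (all prime factors `≤ μ·log c`) / the rest -/

/-- Finiteness of the very smooth abc triples: for every `0 < μ < 1` only finitely many abc triples have
all their prime factors `≤ μ·log c` (an "xyz"-type statement at exponent one; implied by abc since such
a triple has `rad(abc) ≤ e^{ϑ(μ log c)} = c^{μ+o(1)}`). -/
def SmoothFinite : Prop :=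
  ∀ μ : ℝ, 0 < μ → μ < 1 →
    {t : ℕ × ℕ × ℕ | IsABCTriple t.1 t.2.1 t.2.2 ∧
      ∀ p ∈ (t.1 * t.2.1 * t.2.2).primeFactors, (p : ℝ) ≤ μ * Real.log t.2.2}.Finite

/-- abc on the deep tail for the NON-smooth triples (some prime factor `> μ·log c`), the prover choosing
`μ ∈ (0,1)`. -/
def XNonSmooth : Prop :=
  ∀ ε : ℝ, 0 < ε → ∃ μ : ℝ, 0 < μ ∧ μ < 1 ∧ ∃ K : ℕ, ∃ C : ℝ, 0 < C ∧ ∀ a b c : ℕ,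
    IsABCTriple a b c →
    K ≤ ((a * b * c).primeFactors.filter (fun p => 5 ≤ (a * b * c).factorization p)).card →
    (∃ p ∈ (a * b * c).primeFactors, μ * Real.log c < (p : ℝ)) →
    (c : ℝ) < C * ((rad a b c : ℕ) : ℝ) ^ (1 + ε)

/-- D6 assembly: the smooth deep triples are finitely many, hence bounded, hence absorbed into the
constant. [folklore] -/
theorem d6_assembly (hS : SmoothFinite) (hN : XNonSmooth) : DeepRegimeABC := by
  intro ε hε
  obtain ⟨μ, hμ, hμ1, K, C, hC, h⟩ := hN ε hε
  obtain ⟨B, hB⟩ := exists_bound_of_finite (hS μ hμ hμ1)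
  refine ⟨K, max C (B + 1), lt_max_of_lt_left hC, fun a b c habc hK => ?_⟩
  have hr1 : (1 : ℝ) ≤ ((rad a b c : ℕ) : ℝ) ^ (1 + ε) := one_le_rad_rpow' a b c hε
  have hr : (0 : ℝ) ≤ ((rad a b c : ℕ) : ℝ) ^ (1 + ε) := zero_le_one.trans hr1
  by_cases hsm : ∃ p ∈ (a * b * c).primeFactors, μ * Real.log c < (p : ℝ)
  · exact (h a b c habc hK hsm).trans_le (mul_le_mul_of_nonneg_right (le_max_left _ _) hr)
  · push Not at hsm
    have hmem : ((a, b, c) : ℕ × ℕ × ℕ) ∈ {t : ℕ × ℕ × ℕ | IsABCTriple t.1 t.2.1 t.2.2 ∧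
        ∀ p ∈ (t.1 * t.2.1 * t.2.2).primeFactors, (p : ℝ) ≤ μ * Real.log t.2.2} := ⟨habc, hsm⟩
    exact lt_max_mul_of_le (hB _ hmem) hr1

theorem xNonSmooth_of_crux (h : DeepRegimeABC) : XNonSmooth := by
  intro ε hε
  obtain ⟨K, C, hC, hK⟩ := h ε hε
  exact ⟨1 / 2, by norm_num, by norm_num, K, C, hC, fun a b c habc hKle _ => hK a b c habc hKle⟩

/-- `ABC → SmoothFinite` restricted to `μ ≤ 1/2` (the full range `μ < 1` needs `ϑ(x) ≤ (1+o(1))x`;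
with Chebyshev's `n# ≤ 4ⁿ` from Mathlib we get `rad(abc) ≤ 4^{μ log c} = c^{μ log 4} ≤ c^{0.7}`, and abc at
`ε = 1/10` then bounds `c^{0.23} < C`). [folklore] -/
theorem smoothFinite_half_of_abc (hA : _root_.ABC) :
    ∀ μ : ℝ, 0 < μ → μ ≤ 1 / 2 →
      {t : ℕ × ℕ × ℕ | IsABCTriple t.1 t.2.1 t.2.2 ∧
        ∀ p ∈ (t.1 * t.2.1 * t.2.2).primeFactors, (p : ℝ) ≤ μ * Real.log t.2.2}.Finite := by
  intro μ hμ hμ2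
  obtain ⟨C, hC, hABC⟩ := (ABC_iff.mp hA) (1 / 10) (by norm_num)
  have hlog4 : Real.log 4 ≤ 1.3863 := by
    have e : Real.log 4 = 2 * Real.log 2 := by
      rw [show (4 : ℝ) = 2 ^ 2 by norm_num, Real.log_pow]; norm_num
    rw [e]; have := Real.log_two_lt_d9; linarith
  have hl4 : 0 ≤ Real.log 4 := Real.log_nonneg (by norm_num)
  -- every member has `c^{0.23} < C`
  have key : ∀ t ∈ {t : ℕ × ℕ × ℕ | IsABCTriple t.1 t.2.1 t.2.2 ∧
      ∀ p ∈ (t.1 * t.2.1 * t.2.2).primeFactors, (p : ℝ) ≤ μ * Real.log t.2.2},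
      (t.2.2 : ℝ) ^ (23 / 100 : ℝ) < C := by
    rintro ⟨a, b, c⟩ ⟨habc, hsmooth⟩
    dsimp only at habc hsmooth ⊢
    obtain ⟨ha, hb, hsum, hcop⟩ := habc
    have hc : 0 < c := by omega
    have hcR : (0 : ℝ) < c := by exact_mod_cast hc
    have hc1 : (1 : ℝ) ≤ c := by exact_mod_cast hc
    set n : ℕ := ⌊μ * Real.log c⌋₊ with hn
    have hsub : (a * b * c).primeFactors ⊆ (Finset.range (n + 1)).filter Nat.Prime := by
      intro p hp
      have hpp := Nat.prime_of_mem_primeFactors hp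
      have hple : p ≤ n := by rw [hn]; exact Nat.le_floor (hsmooth p hp)
      exact Finset.mem_filter.mpr ⟨Finset.mem_range.mpr (Nat.lt_succ_of_le hple), hpp⟩
    have hrad_le : rad a b c ≤ 4 ^ n := by
      have hdvd : rad a b c ∣ primorial n := by
        rw [rad_def, Nat.radical_eq_prod_primeFactors, primorial]
        exact Finset.prod_dvd_prod_of_subset _ _ _ hsub
      exact (Nat.le_of_dvd (primorial_pos n) hdvd).trans (primorial_le_four_pow n)
    have hradR : ((rad a b c : ℕ) : ℝ) ≤ (c : ℝ) ^ (7 / 10 : ℝ) := by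
      have h1 : ((rad a b c : ℕ) : ℝ) ≤ (4 : ℝ) ^ (n : ℕ) := by exact_mod_cast hrad_le
      have hn_le : (n : ℝ) ≤ μ * Real.log c := by
        rw [hn]; exact Nat.floor_le (mul_nonneg hμ.le (Real.log_nonneg hc1))
      have h2 : (4 : ℝ) ^ (n : ℕ) ≤ (c : ℝ) ^ (μ * Real.log 4) := by
        rw [← Real.rpow_natCast, Real.rpow_def_of_pos (by norm_num : (0 : ℝ) < 4),
          Real.rpow_def_of_pos hcR]
        apply Real.exp_le_exp.mpr
        have h3 := mul_le_mul_of_nonneg_left hn_le hl4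
        calc Real.log 4 * ((n : ℕ) : ℝ) ≤ Real.log 4 * (μ * Real.log c) := h3
          _ = Real.log c * (μ * Real.log 4) := by ring
      have h3 : (c : ℝ) ^ (μ * Real.log 4) ≤ (c : ℝ) ^ (7 / 10 : ℝ) := by
        apply Real.rpow_le_rpow_of_exponent_le hc1
        nlinarith [mul_le_mul_of_nonneg_left hlog4 hμ.le]
      exact h1.trans (h2.trans h3)
    have hmain := hABC a b c ⟨ha, hb, hsum, hcop⟩
    have h77 : ((rad a b c : ℕ) : ℝ) ^ (1 + 1 / 10 : ℝ) ≤ (c : ℝ) ^ (77 / 100 : ℝ) := by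
      calc ((rad a b c : ℕ) : ℝ) ^ (1 + 1 / 10 : ℝ)
          ≤ ((c : ℝ) ^ (7 / 10 : ℝ)) ^ (1 + 1 / 10 : ℝ) :=
            Real.rpow_le_rpow (Nat.cast_nonneg _) hradR (by norm_num)
        _ = (c : ℝ) ^ (77 / 100 : ℝ) := by rw [← Real.rpow_mul hcR.le]; norm_num
    have hc77 : (c : ℝ) < C * (c : ℝ) ^ (77 / 100 : ℝ) :=
      hmain.trans_le (mul_le_mul_of_nonneg_left h77 hC.le)
    have hc77' : (c : ℝ) ^ (23 / 100 : ℝ) * (c : ℝ) ^ (77 / 100 : ℝ) < C * (c : ℝ) ^ (77 / 100 : ℝ) := by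
      rwa [← Real.rpow_add hcR, show (23 / 100 : ℝ) + 77 / 100 = 1 by norm_num, Real.rpow_one]
    exact lt_of_mul_lt_mul_right hc77' (Real.rpow_nonneg hcR.le _)
  -- finiteness: all coordinates `≤ B := ⌈C^{100/23}⌉₊`
  set B : ℕ := ⌈C ^ (100 / 23 : ℝ)⌉₊ with hBdef
  refine Set.Finite.subset ((Set.finite_Iic B).prod ((Set.finite_Iic B).prod (Set.finite_Iic B))) ?_
  rintro ⟨a, b, c⟩ ht
  have hlt := key _ ht
  obtain ⟨⟨ha, hb, hsum, _⟩, _⟩ := ht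
  dsimp only at ha hb hsum hlt
  have hcR : (0 : ℝ) ≤ c := Nat.cast_nonneg _
  have hcC : (c : ℝ) < C ^ (100 / 23 : ℝ) := by
    have e : (c : ℝ) = ((c : ℝ) ^ (23 / 100 : ℝ)) ^ (100 / 23 : ℝ) := by
      rw [← Real.rpow_mul hcR]; norm_num
    rw [e]
    exact Real.rpow_lt_rpow (Real.rpow_nonneg hcR _) hlt (by norm_num)
  have hcB : c ≤ B := by
    rw [hBdef]; exact_mod_cast hcC.le.trans (Nat.le_ceil _)
  simp only [Set.mem_prod, Set.mem_Iic]
  exact ⟨by omega, by omega, hcB⟩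

/-! ## D7 — powerful corner (5-full deep triples) / the rest -/

/-- Finiteness of the 5-FULL abc triples with many prime factors (Erdős–Nitaj territory: even
"finitely many coprime 5-full `a + b = c`" is open; abc gives it since then `rad ≤ (abc)^{1/5} ≤ c^{3/5}`). -/
def PowerfulTailFinite : Prop :=
  ∃ K : ℕ, {t : ℕ × ℕ × ℕ | IsABCTriple t.1 t.2.1 t.2.2 ∧
      K ≤ (t.1 * t.2.1 * t.2.2).primeFactors.card ∧
      ∀ p ∈ (t.1 * t.2.1 * t.2.2).primeFactors, 5 ≤ (t.1 * t.2.1 * t.2.2).factorization p}.Finite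

/-- abc on the deep tail for triples that are NOT 5-full (some prime at multiplicity `≤ 4`). -/
def XNotFull : Prop :=
  ∀ ε : ℝ, 0 < ε → ∃ K : ℕ, ∃ C : ℝ, 0 < C ∧ ∀ a b c : ℕ, IsABCTriple a b c →
    K ≤ ((a * b * c).primeFactors.filter (fun p => 5 ≤ (a * b * c).factorization p)).card →
    (∃ p ∈ (a * b * c).primeFactors, (a * b * c).factorization p ≤ 4) →
    (c : ℝ) < C * ((rad a b c : ℕ) : ℝ) ^ (1 + ε)

/-- D7 assembly. [folklore] -/
theorem d7_assembly (hP : PowerfulTailFinite) (hN : XNotFull) : DeepRegimeABC := by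
  intro ε hε
  obtain ⟨K₁, hfin⟩ := hP
  obtain ⟨K₂, C, hC, h⟩ := hN ε hε
  obtain ⟨B, hB⟩ := exists_bound_of_finite hfin
  refine ⟨max K₁ K₂, max C (B + 1), lt_max_of_lt_left hC, fun a b c habc hK => ?_⟩
  have hr1 : (1 : ℝ) ≤ ((rad a b c : ℕ) : ℝ) ^ (1 + ε) := one_le_rad_rpow' a b c hε
  have hr : (0 : ℝ) ≤ ((rad a b c : ℕ) : ℝ) ^ (1 + ε) := zero_le_one.trans hr1
  by_cases hnf : ∃ p ∈ (a * b * c).primeFactors, (a * b * c).factorization p ≤ 4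
  · exact (h a b c habc ((le_max_right _ _).trans hK) hnf).trans_le
      (mul_le_mul_of_nonneg_right (le_max_left _ _) hr)
  · push Not at hnf
    have hall : ∀ p ∈ (a * b * c).primeFactors, 5 ≤ (a * b * c).factorization p :=
      fun p hp => by have := hnf p hp; omega
    have hfilter : ((a * b * c).primeFactors.filter (fun p => 5 ≤ (a * b * c).factorization p)) =
        (a * b * c).primeFactors := Finset.filter_true_of_mem hall
    rw [hfilter] at hK
    have hmem : ((a, b, c) : ℕ × ℕ × ℕ) ∈ {t : ℕ × ℕ × ℕ | IsABCTriple t.1 t.2.1 t.2.2 ∧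
        K₁ ≤ (t.1 * t.2.1 * t.2.2).primeFactors.card ∧
        ∀ p ∈ (t.1 * t.2.1 * t.2.2).primeFactors, 5 ≤ (t.1 * t.2.1 * t.2.2).factorization p} :=
      ⟨habc, (le_max_left _ _).trans hK, hall⟩
    exact lt_max_mul_of_le (hB _ hmem) hr1

theorem xNotFull_of_crux (h : DeepRegimeABC) : XNotFull := by
  intro ε hε
  obtain ⟨K, C, hC, hK⟩ := h ε hε
  exact ⟨K, C, hC, fun a b c habc hKle _ => hK a b c habc hKle⟩

/-- `DeepRegimeABC → PowerfulTailFinite`: on a 5-full triple `rad(abc)⁵ ∣ abc ≤ c³/4`, so the crux at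
`ε := 1/4` bounds `c` on its cell: `c < C·rad^{5/4} ≤ C·c^{3/4}`, i.e. `c < C⁴`. [folklore] -/
theorem powerfulTailFinite_of_crux (h : DeepRegimeABC) : PowerfulTailFinite := by
  obtain ⟨K, C, hC, hK⟩ := h (1 / 4) (by norm_num)
  refine ⟨K, ?_⟩
  -- every member has `c ≤ C⁴`; a set of triples with bounded coordinates is finite
  have key : ∀ t ∈ {t : ℕ × ℕ × ℕ | IsABCTriple t.1 t.2.1 t.2.2 ∧
      K ≤ (t.1 * t.2.1 * t.2.2).primeFactors.card ∧
      ∀ p ∈ (t.1 * t.2.1 * t.2.2).primeFactors, 5 ≤ (t.1 * t.2.1 * t.2.2).factorization p},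
      (t.2.2 : ℝ) < C ^ (4 : ℝ) := by
    rintro ⟨a, b, c⟩ ⟨habc, hKle, hfull⟩
    dsimp only at habc hKle hfull ⊢
    obtain ⟨ha, hb, hsum, hcop⟩ := habc
    have hc : 0 < c := by omega
    have hN0 : a * b * c ≠ 0 := by positivity
    -- radical bound: `rad(abc)⁵ ∣ abc` on a 5-full triple
    have hfac : ∏ p ∈ (a * b * c).primeFactors, p ^ (a * b * c).factorization p = a * b * c := by
      conv_rhs => rw [← Nat.prod_factorization_pow_eq_self hN0,
        Nat.prod_factorization_eq_prod_primeFactors]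
    have hrad_dvd : (rad a b c) ^ 5 ∣ a * b * c := by
      rw [rad_def, Nat.radical_eq_prod_primeFactors, ← Finset.prod_pow]
      conv_rhs => rw [← hfac]
      exact Finset.prod_dvd_prod_of_dvd _ _ fun p hp => pow_dvd_pow p (hfull p hp)
    have hrad_le : (rad a b c) ^ 5 ≤ a * b * c := Nat.le_of_dvd (Nat.pos_of_ne_zero hN0) hrad_dvd
    have habc_le : a * b * c ≤ c ^ 3 := by
      have ha' : a ≤ c := by omega
      have hb' : b ≤ c := by omega
      calc a * b * c ≤ c * c * c := by gcongr
        _ = c ^ 3 := by ring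
    -- real-number bookkeeping
    have hcR : (0 : ℝ) < c := by exact_mod_cast hc
    have hR0 : (0 : ℝ) ≤ (rad a b c : ℕ) := Nat.cast_nonneg _
    have h5 : ((rad a b c : ℕ) : ℝ) ^ (5 : ℕ) ≤ (c : ℝ) ^ (3 : ℕ) := by
      exact_mod_cast hrad_le.trans habc_le
    have hlt := hK a b c ⟨ha, hb, hsum, hcop⟩ (by
      rw [Finset.filter_true_of_mem hfull]; exact hKle)
    -- `rad^{5/4} ≤ c^{3/4}`
    have hrad54 : ((rad a b c : ℕ) : ℝ) ^ (1 + 1 / 4 : ℝ) ≤ (c : ℝ) ^ (3 / 4 : ℝ) := by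
      have e1 : ((rad a b c : ℕ) : ℝ) ^ (1 + 1 / 4 : ℝ) =
          (((rad a b c : ℕ) : ℝ) ^ (5 : ℕ)) ^ (1 / 4 : ℝ) := by
        rw [← Real.rpow_natCast _ 5, ← Real.rpow_mul hR0]; norm_num
      have e2 : (c : ℝ) ^ (3 / 4 : ℝ) = ((c : ℝ) ^ (3 : ℕ)) ^ (1 / 4 : ℝ) := by
        rw [← Real.rpow_natCast _ 3, ← Real.rpow_mul hcR.le]; norm_num
      rw [e1, e2]
      exact Real.rpow_le_rpow (by positivity) h5 (by norm_num)
    have hc34 : (c : ℝ) < C * (c : ℝ) ^ (3 / 4 : ℝ) :=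
      hlt.trans_le (mul_le_mul_of_nonneg_left hrad54 hC.le)
    -- hence `c^{1/4} < C`, `c < C^4`
    have hc14 : (c : ℝ) ^ (1 / 4 : ℝ) < C := by
      have hc34' : (c : ℝ) ^ (1 / 4 : ℝ) * (c : ℝ) ^ (3 / 4 : ℝ) < C * (c : ℝ) ^ (3 / 4 : ℝ) := by
        rwa [← Real.rpow_add hcR, show (1 / 4 : ℝ) + 3 / 4 = 1 by norm_num, Real.rpow_one]
      exact lt_of_mul_lt_mul_right hc34' (Real.rpow_nonneg hcR.le _)
    have hc0' : (0 : ℝ) ≤ (c : ℝ) ^ (1 / 4 : ℝ) := Real.rpow_nonneg hcR.le _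
    calc (c : ℝ) = ((c : ℝ) ^ (1 / 4 : ℝ)) ^ (4 : ℝ) := by
          rw [← Real.rpow_mul hcR.le]; norm_num
      _ < C ^ (4 : ℝ) := Real.rpow_lt_rpow hc0' hc14 (by norm_num)
  -- finiteness: coordinates bounded by `B := ⌈C^4⌉₊`
  set B : ℕ := ⌈C ^ (4 : ℝ)⌉₊ with hBdef
  refine Set.Finite.subset ((Set.finite_Iic B).prod ((Set.finite_Iic B).prod (Set.finite_Iic B))) ?_
  rintro ⟨a, b, c⟩ ht
  have hcB : (c : ℝ) < C ^ (4 : ℝ) := key _ ht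
  obtain ⟨⟨ha, hb, hsum, _⟩, _, _⟩ := ht
  dsimp only at ha hb hsum hcB
  have hcB' : c ≤ B := by
    rw [hBdef]; exact_mod_cast hcB.le.trans (Nat.le_ceil _)
  simp only [Set.mem_prod, Set.mem_Iic]
  exact ⟨by omega, by omega, hcB'⟩

end Summit.ABC.ABC.Cruxes.DeepRegimeABC.StrategistR1
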